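import Summits.BirchSwinnertonDyer.BirchSwinnertonDyer.Theorems.PrintX9KatoEulerHalfRecord
import Literature.NumberTheory.EllipticCurves.Fouquet2025.CongruenceTransportFromSeedMainIdentityProofs
import HarnessLib

/-!
# The rank-0 UNIT-cell door in CENSUS currency: `p ∤ a_p − 1` (decided from the point count) and
# `v_p(L(E,1)/Ω_E) = 0` (Cremona's `L/Ω`, two engines) replace the datum `‖L_p(f,α)(0)‖ = 1`
# (print cell `bsd-print-x9`, seat p3; OFFER-X9-KATO-EULER door D2 in record form; theorems only)

`Theorems/PrintX9KatoEulerHalfRecord.lean` states door D2 with the engine datum `‖L_p(f, α)(0)‖ = 1` for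
the newform of level `N_E`. By the interpolation `L_p(f, α)(0) = (1 − α⁻¹)² · [0]⁺_f`
(`constantCoeff_padicLFunction_unitRoot`), `‖1 − α⁻¹‖ = 1 iff `p ∤ a_p − 1`
(`norm_one_sub_inv_unitRoot_eq_one`), `[0]⁺_f · Ω⁺_f = L(E,1)` and the period unit
`Ω_E = u · Ω⁺_f`, `‖u‖_p = 1` (fact A25 `realPeriodRat_eq_unit_mul_plusPeriod`, `p ≥ 5`, `E[p]` irreducible),
that datum is EQUIVALENT to the census pair (non-anomalous, `v_p(L(E,1)/Ω_E) = 0`) — the first is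
kernel-DECIDED from the schema count `#Ẽ(𝔽_p) = n_p` (`a_p − 1 = p − n_p`), the second is Cremona's
`L/Ω` column (engine 1) against Sage's exact `L_ratio` (engine 2). This file proves the conversion
(`IrrOrd.norm_coeff_zero_padicLFunction_eq_one_of_census`) and the resulting doors
`IrrOrd.bsdp_of_fine_of_nonanomalous_of_padicValRat_L` (class-free) and
`Record.bsdp_of_ainvs_of_fine_of_nonanomalous_of_padicValRat_L` (literal model; ONE engine datum: the
rational `q = L(E,1)/Ω_E` with `v_p(q) = 0`). Binders: F1 (LITERAL token), `hGr`, `hmodP`, `hGZK`, `h5`.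
Per pair; nothing booked.

References: [MazurTateTeitelbaum1986Invent] §I.14; [GreenbergVatsal2000] §3 Rem. 3.4, Prop. 3.7;
[Kato2004Asterisque] Thm. 17.4; [GreenbergLNM1716] Thm. 4.1; [Mazur1978] Prop. 6.3 (1); [Miller2011LMS] Def. 1.1.
-/

set_option linter.dupNamespace false
set_option autoImplicit false

noncomputable section

open scoped Classical MatrixGroups ModularForm

open CongruenceSubgroup WeierstrassCurve Literature.NumberTheory.EllipticCurves
  Literature.NumberTheory.EllipticCurves.ModularForms Literature.NumberTheory.EllipticCurves.Rank1Residual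
  Literature.NumberTheory.EllipticCurves.Kato2004
  Literature.NumberTheory.EllipticCurves.Rank1Residual.X11RankOneCertificates
  Literature.NumberTheory.EllipticCurves.Fouquet2025
  Summit.BirchSwinnertonDyer.BirchSwinnertonDyer.Rank1Residual.IntModel
  Summit.BirchSwinnertonDyer.BirchSwinnertonDyer.Rank1Residual.X11RankOne
  Summit.BirchSwinnertonDyer.BirchSwinnertonDyer.Theorems.Rank1ResidualX1Defs
  Summit.BirchSwinnertonDyer.Rank1Residual

namespace Summit.BirchSwinnertonDyer.BirchSwinnertonDyer.Rank1Residual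

variable (W : WeierstrassCurve ℚ) [W.IsElliptic] [W.IsGloballyMinimal] (p : ℕ) [Fact p.Prime]

/-- **Census currency ⟹ the unit-cell datum.** At a good ordinary `p ≥ 5` with `E[p]` irreducible: if
`p ∤ a_p − 1` (non-anomalous) and `L(E,1)/Ω_E = q ∈ ℚ^×` with `v_p(q) = 0`, then `‖L_p(f, α)(0)‖ = 1` for
every newform `f` of `E` at level `N_E`. Proof: `Ω_E = u·Ω⁺_f` with `‖u‖_p = 1` (A25), so
`[0]⁺_f = L(E,1)/Ω⁺_f = q·u` has valuation `0`; then `norm_constantCoeff_padicLFunction_eq_one_of_padicValRat_eq_zero`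
(interpolation + `‖1 − α⁻¹‖ = 1`). [cite: MazurTateTeitelbaum1986Invent, §I.14 (14.3)]
[cite: GreenbergVatsal2000, §3 Remark (3.4)] -/
theorem IrrOrd.norm_coeff_zero_padicLFunction_eq_one_of_census (h5 : realPeriodRat_eq_unit_mul_plusPeriod)
    (hp : 5 ≤ p) (hgood : W.HasGoodReductionAtPrime p) (hord : ¬ (p : ℤ) ∣ W.frobeniusTrace p)
    (hirr : W.HasIrreducibleModPGaloisRep p) (hna : ¬ (p : ℤ) ∣ W.frobeniusTrace p - 1)
    (hL : ∃ q : ℚ, q ≠ 0 ∧ W.entireLFunction 1 / (W.realPeriodRat : ℂ) = (q : ℂ) ∧ padicValRat p q = 0) :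
    ∀ [NeZero (W.conductorNorm ℤ)] (f : CuspForm (Gamma0 (W.conductorNorm ℤ)) 2), IsNewformOf W f →
      ‖PowerSeries.coeff 0 (padicLFunction f (unitRoot W p : ℚ_[p]))‖ = 1 := by
  intro _ f hf
  obtain ⟨q, hq0, hqeq, hqv⟩ := hL
  obtain ⟨u, hu1, huΩ⟩ := h5 W p hp hgood hirr f hf
  have hΩpos : 0 < W.realPeriodRat := W.realPeriodRat_pos_holds
  have hplus : 0 < plusPeriod f := IsNewform0.plusPeriod_pos_holds hf.1 hf.coeffField_eq_bot
  have hu0 : u ≠ 0 := by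
    rintro rfl
    rw [Rat.cast_zero, zero_mul] at huΩ
    exact hΩpos.ne' huΩ
  -- the period ratio `ϖ = u⁻¹`: `ϖ · Ω_E = Ω⁺_f`, a `p`-adic unit by A25
  have hϖeq : ((u⁻¹ : ℚ) : ℝ) * W.realPeriodRat = plusPeriod f := by
    rw [huΩ]; push_cast; field_simp
  have hϖv : padicValRat p u⁻¹ = 0 := padicValRat_periodRatio_eq_zero_of_five_le h5 W p hp hgood hirr f hf _ hϖeq
  -- `[0]⁺_f = q · u`
  set s : ℚ := ratPlusSymbol f 0 with hs_def
  have hLval : W.entireLFunction 1 = (((s : ℝ) * plusPeriod f : ℝ) : ℂ) := hf.entireLFunction_one_eq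
  have ht : W.entireLFunction 1 / (W.realPeriodRat : ℂ) = ((s / u : ℚ) : ℂ) := by
    rw [hLval, div_eq_iff (Complex.ofReal_ne_zero.mpr hΩpos.ne'), huΩ]
    push_cast
    field_simp
  have hqs : q = s / u := by exact_mod_cast hqeq.symm.trans ht
  have hs : s = q * u⁻¹⁻¹ := by rw [hqs, inv_inv]; field_simp
  have hs0 : s ≠ 0 := by rw [hs]; exact mul_ne_zero hq0 (inv_ne_zero (inv_ne_zero hu0))
  have hsv : padicValRat p s = 0 := by
    rw [hs, padicValRat.mul hq0 (inv_ne_zero (inv_ne_zero hu0)), padicValRat.inv, hϖv, hqv]; simp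
  rw [PowerSeries.coeff_zero_eq_constantCoeff_apply]
  exact norm_constantCoeff_padicLFunction_eq_one_of_padicValRat_eq_zero W p ⟨hgood, hord⟩ f hf hna hs0 hsv

/-- **Door D2 in census currency, class-free: `p ≥ 5` good ordinary NON-ANOMALOUS, `E[p]` irreducible
(any image), `v_p(L(E,1)/Ω_E) = 0`: F1 + `hGr` + `hmodP` + `hGZK` + `h5` ⟹ `BSD(E,p)`.**
[cite: Kato2004Asterisque, Thm. 17.4 (2) (p. 273)] [cite: GreenbergLNM1716, Thm. 4.1 (p. 102)]
[cite: MazurTateTeitelbaum1986Invent, §I.14 (14.3)] [cite: Miller2011LMS, Def. 1.1 (arXiv:1010.2431 p. 3)] -/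
theorem IrrOrd.bsdp_of_fine_of_nonanomalous_of_padicValRat_L
    (hfine : exists_divisibilityInputs_fineQuotient_zeta) (hGr : greenberg_charValue_rankZero)
    (hmodP : nonempty_modularParametrizationData) (hGZK : rank_eq_analyticRank_of_analyticRank_le_one)
    (h5 : realPeriodRat_eq_unit_mul_plusPeriod) (hp : 5 ≤ p) (hgood : W.HasGoodReductionAtPrime p)
    (hord : ¬ (p : ℤ) ∣ W.frobeniusTrace p) (hirr : W.HasIrreducibleModPGaloisRep p)
    (hna : ¬ (p : ℤ) ∣ W.frobeniusTrace p - 1)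
    (hL : ∃ q : ℚ, q ≠ 0 ∧ W.entireLFunction 1 / (W.realPeriodRat : ℂ) = (q : ℂ) ∧ padicValRat p q = 0) :
    BSDp W p :=
  IrrOrd.bsdp_of_fine_of_norm_constantCoeff_eq_one W p hfine hGr hmodP hGZK h5 hp hgood hord hirr
    (IrrOrd.norm_coeff_zero_padicLFunction_eq_one_of_census W p h5 hp hgood hord hirr hna hL)

/-- **RECORD shape of door D2 in census currency**: literal integer model `[a₁,…,a₆]`, `p ∤ Δ`,
`countPoints [a₁,…,a₆] p = n_p` with `p ∤ p + 1 − n_p` (ordinary) AND `p ∤ p − n_p` (non-anomalous: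
`a_p − 1 = p − n_p`), a Frobenius witness `ℓ` (irreducibility), and ONE engine datum: the rational
`q = L(E,1)/Ω_E ≠ 0` (Cremona's `L/Ω`) with `v_p(q) = 0`. F1 ⇒ LITERAL tier; per pair.
[cite: Kato2004Asterisque, Thm. 17.4 (2) (p. 273)] [cite: Mazur1978, §6 Prop. 6.3 (1) (p. 153)]
[cite: Miller2011LMS, Def. 1.1 (arXiv:1010.2431 p. 3)] -/
theorem Record.bsdp_of_ainvs_of_fine_of_nonanomalous_of_padicValRat_L
    (hfine : exists_divisibilityInputs_fineQuotient_zeta) (hGr : greenberg_charValue_rankZero)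
    (hmodP : nonempty_modularParametrizationData) (hGZK : rank_eq_analyticRank_of_analyticRank_le_one)
    (h5 : realPeriodRat_eq_unit_mul_plusPeriod)
    (a1 a2 a3 a4 a6 : ℤ) {W : WeierstrassCurve ℚ} [W.IsElliptic] [W.IsGloballyMinimal]
    (hW : integralModelInt W = ⟨a1, a2, a3, a4, a6⟩) (p : ℕ) [Fact p.Prime] (hp : 5 ≤ p)
    (ℓ n np : ℕ) [Fact ℓ.Prime] (hpΔ : ¬ (p : ℤ) ∣ discOf [a1, a2, a3, a4, a6])
    (hcp : countPoints [a1, a2, a3, a4, a6] p = np) (hordp : ¬ (p : ℤ) ∣ (p : ℤ) + 1 - np)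
    (hnap : ¬ (p : ℤ) ∣ (p : ℤ) - np)
    (hℓ2 : ℓ ≠ 2) (hℓp : ℓ ≠ p) (hℓΔ : ¬ (ℓ : ℤ) ∣ discOf [a1, a2, a3, a4, a6])
    (hc : countPoints [a1, a2, a3, a4, a6] ℓ = n)
    (hnoroot : ∀ t : ℕ, t < p → ¬ (p : ℤ) ∣ (t : ℤ) ^ 2 - ((ℓ : ℤ) + 1 - n) * t + ℓ)
    (hL : ∃ q : ℚ, q ≠ 0 ∧ W.entireLFunction 1 / (W.realPeriodRat : ℂ) = (q : ℂ) ∧ padicValRat p q = 0) :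
    BSDp W p := by
  obtain ⟨hgood, hord, hirr⟩ := Record.goodOrdIrr_of_ainvs_of_countPoints a1 a2 a3 a4 a6 hW p (by omega)
    ℓ n np hpΔ hcp hordp hℓ2 hℓp hℓΔ hc hnoroot
  have hΔ : (⟨a1, a2, a3, a4, a6⟩ : WeierstrassCurve ℤ).Δ = discOf [a1, a2, a3, a4, a6] :=
    intCurve_Δ a1 a2 a3 a4 a6
  have hcardp : Nat.card (((⟨a1, a2, a3, a4, a6⟩ : WeierstrassCurve ℤ).map
      (Int.castRingHom (ZMod p))).toAffine.Point) = np := by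
    have h := X11b.natCard_point_eq_countPoints a1 a2 a3 a4 a6 p (by omega) (by rw [hΔ]; exact hpΔ)
    rw [hcp] at h
    exact_mod_cast h
  have hna : ¬ (p : ℤ) ∣ W.frobeniusTrace p - 1 := by
    rw [frobeniusTrace_eq hW hcardp, show (p : ℤ) + 1 - np - 1 = (p : ℤ) - np by ring]; exact hnap
  exact IrrOrd.bsdp_of_fine_of_nonanomalous_of_padicValRat_L W p hfine hGr hmodP hGZK h5 hp hgood hord hirr
    hna hL

end Summit.BirchSwinnertonDyer.BirchSwinnertonDyer.Rank1Residual

end
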